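import Mathlib.Analysis.Convex.SimplicialComplex.Basic
import Mathlib.Analysis.Normed.Module.FiniteDimension
import Mathlib.Topology.Homeomorph.Lemmas
import HarnessLib

/-!
# Compressibility and monotone connectivity of a pair `(M, U)`

The connectivity hypothesis of the topological engulfing theorem (Rushing 1973, Thm. 4.12.1:
"Let `(M, U)` be monotonically `r`-connected") in the form in which the proof consumes it.
Rushing (§4.12, p. 200): *the pair `(M, U)` is monotonically `r`-connected if given any compact
subset `C₁` of `U`, there exists a closed (rel `M`) subset `C₂` of `U` containing `C₁` such that
`(M - C₂, U - C₂)` is `r`-connected*; and `r`-connectedness of a pair `(Y, B)` enters the proof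
only through the **compression property** for finite simplicial pairs of relative dimension
`≤ r` (Rushing, proof of 4.12.1: "Such an `h` exists because `πᵢ(M - C₂, U - C₂) = 0`,
`i ≤ r`"; the equivalence of `πᵢ(Y, B) = 0 (i ≤ r)` with compression of `r`-dimensional relative
CW pairs is the compression lemma, Hatcher, *Algebraic Topology*, Lemma 4.6).  We therefore
define

* `Compressible r Y B` — every map `g` of a finite geometric simplicial complex `L` (in any
  finite-dimensional real normed space) into `Y`, sending the subpolyhedron `|L₀|` of a subfamily
  `L₀` into `B`, with the faces outside `L₀` of dimension `≤ r`, is homotopic inside `Y`,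
  relative to `|L₀|`, to a map into `B`;
* `MonotoneConn r U` — Rushing's monotone `r`-connectedness of `(M, U)` with `r`-connected
  read as `Compressible r`;

and record the formal properties the engulfing induction uses: monotonicity in `r`
(`Compressible.anti`, `MonotoneConn.anti`) and transport under homeomorphisms of `M`
(`Compressible.image`, `MonotoneConn.image`).  No named facts.

## References

* T. B. Rushing, *Topological Embeddings*, Academic Press (1973), §4.12 (p. 200, monotonically
  `r`-connected pairs; proof of Thm. 4.12.1). [Rushing1973]
* A. Hatcher, *Algebraic Topology*, CUP (2002), §4.1, Lemma 4.6 (compression lemma).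
  [HatcherAT2002]
-/

open Set Function

noncomputable section

namespace Literature.Topology.FourManifolds

/-- The polyhedron of a family of vertex sets: the union of their closed simplices. [folklore] -/
def facesSpace {W : Type*} [AddCommGroup W] [Module ℝ W] (F : Set (Finset W)) : Set W :=
  ⋃ s ∈ F, convexHull ℝ (s : Set W)

/-- Auxiliary (`mem_facesSpace_iff`). [folklore] -/
theorem mem_facesSpace_iff {W : Type*} [AddCommGroup W] [Module ℝ W] {F : Set (Finset W)} {x : W} :
    x ∈ facesSpace F ↔ ∃ s ∈ F, x ∈ convexHull ℝ (s : Set W) := by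
  simp only [facesSpace, mem_iUnion, exists_prop]

/-- The polyhedron of the face family of a complex is its space. [folklore] -/
theorem facesSpace_faces {W : Type*} [NormedAddCommGroup W] [NormedSpace ℝ W]
    (L : Geometry.SimplicialComplex ℝ W) : facesSpace L.faces = L.space := by
  ext x
  rw [mem_facesSpace_iff, Geometry.SimplicialComplex.mem_space_iff]

/-- The polyhedron of a subfamily lies in the space. [folklore] -/
theorem facesSpace_mono {W : Type*} [AddCommGroup W] [Module ℝ W] {F G : Set (Finset W)}
    (h : F ⊆ G) : facesSpace F ⊆ facesSpace G := fun _ hx => by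
  obtain ⟨s, hs, hxs⟩ := mem_facesSpace_iff.1 hx
  exact mem_facesSpace_iff.2 ⟨s, h hs, hxs⟩

variable {M : Type*} [TopologicalSpace M]

/-- **Compressibility of the pair `(Y, B)` in relative dimension `≤ r`** — the form of
`r`-connectedness consumed by engulfing: every continuous map `g : |L| → Y` of a finite
geometric simplicial complex `L`, in any finite-dimensional real normed space, which sends the
subpolyhedron `|L₀|` of a down-closed subfamily `L₀ ⊆ L` into `B` and whose faces outside
`L₀` have at most `r + 1` vertices, admits a homotopy `G : |L| × [0, 1] → Y` with `G₁ = g`,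
`G_s = g` on `|L₀|` for all `s`, and `G₀ (|L|) ⊆ B`.
[cite: Rushing1973, §4.12 (proof of Thm. 4.12.1, the homotopy `h`); HatcherAT2002, Lemma 4.6] -/
def Compressible (r : ℕ) (Y B : Set M) : Prop :=
  ∀ (W : Type) [NormedAddCommGroup W] [NormedSpace ℝ W] [FiniteDimensional ℝ W]
    (L : Geometry.SimplicialComplex ℝ W) (_ : L.faces.Finite) (L₀ : Set (Finset W))
    (_ : L₀ ⊆ L.faces) (_ : ∀ s ∈ L₀, ∀ t ⊆ s, t.Nonempty → t ∈ L₀)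
    (_ : ∀ s ∈ L.faces, s ∉ L₀ → s.card ≤ r + 1)
    (g : W → M) (_ : ContinuousOn g L.space) (_ : MapsTo g L.space Y)
    (_ : MapsTo g (facesSpace L₀) B),
    ∃ G : W × ℝ → M, ContinuousOn G (L.space ×ˢ Icc (0 : ℝ) 1) ∧
      (∀ x ∈ L.space, G (x, 1) = g x) ∧
      (∀ x ∈ facesSpace L₀, ∀ s ∈ Icc (0 : ℝ) 1, G (x, s) = g x) ∧
      (∀ x ∈ L.space, G (x, 0) ∈ B) ∧ MapsTo G (L.space ×ˢ Icc (0 : ℝ) 1) Y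

/-- **Monotone `r`-connectedness of `(M, U)`** (Rushing 1973, §4.12): every compact subset
`C₁ ⊆ U` lies in a closed subset `C₂ ⊆ U` of `M` such that the pair `(M ∖ C₂, U ∖ C₂)` is
`r`-compressible. [cite: Rushing1973, §4.12 (definition before Thm. 4.12.1, p. 200)] -/
def MonotoneConn (r : ℕ) (U : Set M) : Prop :=
  ∀ C₁ : Set M, IsCompact C₁ → C₁ ⊆ U →
    ∃ C₂ : Set M, IsClosed C₂ ∧ C₁ ⊆ C₂ ∧ C₂ ⊆ U ∧ Compressible r C₂ᶜ (U \ C₂)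

namespace Compressible

variable {r r' : ℕ} {Y B : Set M}

/-- Compressibility is antitone in the dimension. [folklore] -/
theorem anti (h : Compressible r Y B) (hr : r' ≤ r) : Compressible r' Y B := by
  intro W _ _ _ L hfin L₀ hL₀ hdown hdim g hg hgY hgB
  exact h W L hfin L₀ hL₀ hdown (fun s hs hsL => (hdim s hs hsL).trans (Nat.succ_le_succ hr))
    g hg hgY hgB

/-- **Transport of compressibility under a homeomorphism of the ambient space.** [folklore] -/
theorem image (h : Compressible r Y B) (e : M ≃ₜ M) : Compressible r (e '' Y) (e '' B) := by
  intro W _ _ _ L hfin L₀ hL₀ hdown hdim g hg hgY hgB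
  -- pull `g` back through `e`, compress, push forward
  obtain ⟨G, hG, hG1, hGrel, hG0, hGY⟩ := h W L hfin L₀ hL₀ hdown hdim (e.symm ∘ g)
    (e.symm.continuous.comp_continuousOn hg)
    (fun x hx => by
      obtain ⟨y, hy, hyx⟩ := hgY hx
      show e.symm (g x) ∈ Y
      rw [← hyx, e.symm_apply_apply]; exact hy)
    (fun x hx => by
      obtain ⟨y, hy, hyx⟩ := hgB hx
      show e.symm (g x) ∈ B
      rw [← hyx, e.symm_apply_apply]; exact hy)
  refine ⟨e ∘ G, e.continuous.comp_continuousOn hG, fun x hx => ?_, fun x hx s hs => ?_,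
    fun x hx => ⟨G (x, 0), hG0 x hx, rfl⟩, fun p hp => ⟨G p, hGY hp, rfl⟩⟩
  · show e (G (x, 1)) = g x
    rw [hG1 x hx, Function.comp_apply, e.apply_symm_apply]
  · show e (G (x, s)) = g x
    rw [hGrel x hx s hs, Function.comp_apply, e.apply_symm_apply]

end Compressible

namespace MonotoneConn

variable {r r' : ℕ} {U : Set M}

/-- Monotone connectedness is antitone in the dimension. [folklore] -/
theorem anti (h : MonotoneConn r U) (hr : r' ≤ r) : MonotoneConn r' U := by
  intro C₁ hC₁ hC₁U
  obtain ⟨C₂, hC₂, h12, h2U, hcomp⟩ := h C₁ hC₁ hC₁U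
  exact ⟨C₂, hC₂, h12, h2U, hcomp.anti hr⟩

/-- **Transport of monotone connectedness under a homeomorphism of `M`.** [folklore] -/
theorem image (h : MonotoneConn r U) (e : M ≃ₜ M) : MonotoneConn r (e '' U) := by
  intro C₁ hC₁ hC₁U
  obtain ⟨C₂, hC₂, h12, h2U, hcomp⟩ := h (e.symm '' C₁) (hC₁.image e.symm.continuous) (by
    rintro _ ⟨x, hx, rfl⟩
    obtain ⟨u, hu, hux⟩ := hC₁U hx
    rw [← hux, e.symm_apply_apply]; exact hu)
  refine ⟨e '' C₂, e.isClosedMap _ hC₂, fun x hx => ?_, image_mono h2U, ?_⟩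
  · exact ⟨e.symm x, h12 ⟨x, hx, rfl⟩, e.apply_symm_apply x⟩
  · have h' := hcomp.image e
    rw [e.image_compl, Set.image_sdiff e.injective] at h'
    exact h'

end MonotoneConn

end Literature.Topology.FourManifolds
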